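import Summits.AtomisticToContinuum.Crystallization.Theorems.OverbindingBudgetAffineNearCluster

/-!
# Overbinding budget — the CRITICAL-REFERENCE line of the near-regime crux RD01 (decomp-a2c lens-4 g44, addendum)

Sibling of `…Theorems.OverbindingBudgetAffineNearCluster` (tree, 7d91ac1d…): that file isolates the open content of N = `NearClusterFloor` as the ONE
existential statement RD01 `NearReferenceLowOrders η R Rc δm ρ₁ θ θ₀ κ₁` («there is an admissible reference ẑ of the near class whose orders 0 + 1 are
floored»).  This addendum types the recommended LINE of RD01 (memo `HOME/decomp-a2c-lens-4/g44/memo/NODE-g44-NearFloorOrders.md` §4.1, lever β⁺):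
choose ẑ CRITICAL for the class energy `Φ(z) := ½·pairSum Near G z` on its free sites (clamped collar around far/bad matter + a pinned skeleton of spacing
`ℓ_b`), so that the first order `firstSum Near G y ẑ = 2·dΦ(ẑ)[y − ẑ]` VANISHES IDENTICALLY and only the order-0 floor of an equilibrium reference remains.

* RD0c `NearReferenceCriticalFloor η R Rc δm ρ₁ θ θ₀ κ₁` [NEW · TRUE-type on paper · ATTACKABLE-M/L] — STRONGER than RD01 (PROVED
  `nearReferenceLowOrders_of_critical`), still WEAKER than N's conclusion (PROVED `nearReferenceCritical_of_conclusion`, via ẑ = y).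
* Foreseen split (g45, not typed here): RD0c ⟸ CP (existence + `δm`-Lipschitz admissibility of the pinned–clamped equilibrium: Newton–Kantorovich per
  block from K_at⁰, lattice Green-function decay) ∧ R0 (order-0 floor of that equilibrium: sitewise equation of state about the local strain; odd
  strain-gradient terms cancel by inversion symmetry; even residues `O(K_s²)`, `K_s ≤ C·ε₁`, absorbed by the Cauchy–Born surplus / collar charges / `ν·Q₁`).
-/

namespace Summit.AtomisticToContinuum.Crystallization.Theorems.OverbindingBudgetAffineNearCluster

open scoped BigOperators Classical
open Literature.MathematicalPhysics.StatisticalMechanics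
open Literature.Geometry.DiscreteGeometry (nearestDist)
open Summit.AtomisticToContinuum.Crystallization.Theorems.OverbindingBudgetBalancedCensusStatements
open Summit.AtomisticToContinuum.Crystallization.Theorems.OverbindingBudgetHarmonicNormalForm
open Summit.AtomisticToContinuum.Crystallization.Theorems.OverbindingBudgetLocalHarmonicCertificate
open Summit.AtomisticToContinuum.Crystallization.Theorems.OverbindingBudgetAffineLadder
open Summit.AtomisticToContinuum.Crystallization.Theorems.OverbindingBudgetAffineLocalisation

variable {N : ℕ}
local notation "E3" => EuclideanSpace ℝ (Fin 3)

/-- **RD0c · `NearReferenceCriticalFloor η R Rc δm ρ₁ θ θ₀ κ₁`** — the recommended LINE of RD01 (STRONGER; NEW · TRUE-type on paper · ATTACKABLE-M/L):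
the admissible reference is CRITICAL for the class energy `½·pairSum Near G` on its free sites (clamped collar + a pinned skeleton of spacing `ℓ_b`,
translate chosen by averaging), so the first order VANISHES IDENTICALLY (`firstSum = 2·dΦ(ẑ)[w] = 0`, `w` supported on the free set) and only the ORDER-0
floor of an equilibrium reference remains (sitewise equation of state `W(B(x)) ≥ e⋆`; odd strain-gradient terms cancel by inversion symmetry; even
residues `O(K_s²)`, `K_s ≤ C·ε₁` by two-shell registration, absorbed by the Cauchy–Born surplus `c_W|e|²` or charged to the collar's far/bad neighbours —
`ε₀` is chosen after `κ₁, ν`); existence with `δm`-Lipschitz control = Newton–Kantorovich per block from K_at⁰ (forces of registered near matter are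
`O(ε₁)`).  WHY IT MIGHT FAIL: sup-norm control of the block corrector needs lattice Green-function decay (log ℓ_b loss); zero-strain layers thinner than
≈ 8 nn inside bent near matter carry an even residue the local surplus does not cover (memo §4.1). [lens-4 g44] -/
def NearReferenceCriticalFloor (η R Rc δm ρ₁ θ θ₀ κ₁ : ℝ) : Prop :=
  AffineChartStraightening → ∀ ν : ℝ, 0 < ν →
    ∃ ε₀ : ℝ, 0 < ε₀ ∧ ∀ ε₁ : ℝ, 0 < ε₁ → ε₁ ≤ ε₀ → ∀ δ : ℝ, 0 < δ → δ ≤ 2 →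
      ∃ C : ℝ, 0 ≤ C ∧ ∀ (N : ℕ) (y : Fin N → E3), Function.Injective y →
        ∃ z : Fin N → E3, RefAdmissible η R Rc δm θ₀ ρ₁ ε₁ θ δ y z ∧
          firstSum (nearSet θ₀ ρ₁ ε₁ θ δ y) (goodSet ρ₁ ε₁ θ δ y) y z = 0 ∧
          ((nearSet θ₀ ρ₁ ε₁ θ δ y).card : ℝ) * (⨅ Q : PeriodicConfiguration 3, Q.energyPerParticle lennardJones)
            - C * (((goodSet ρ₁ ε₁ θ δ y)ᶜ).card : ℝ) - κ₁ * ((farSet θ₀ ρ₁ ε₁ θ δ y).card : ℝ)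
            - ν * dispGradSum (101 / 100) (nearSet θ₀ ρ₁ ε₁ θ δ y) (goodSet ρ₁ ε₁ θ δ y) y z
            ≤ 1 / 2 * pairSum (nearSet θ₀ ρ₁ ε₁ θ δ y) (goodSet ρ₁ ε₁ θ δ y) z

/-- **RD0c ⇒ RD01 (PROVED):** a critical reference has no first order. [this file] -/
theorem nearReferenceLowOrders_of_critical {η R Rc δm ρ₁ θ θ₀ κ₁ : ℝ} (h : NearReferenceCriticalFloor η R Rc δm ρ₁ θ θ₀ κ₁) :
    NearReferenceLowOrders η R Rc δm ρ₁ θ θ₀ κ₁ := by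
  intro hR ν hν
  obtain ⟨ε₀, hε₀, h'⟩ := h hR ν hν
  refine ⟨ε₀, hε₀, fun ε₁ hε₁ hε₁le δ hδ hδ2 => ?_⟩
  obtain ⟨C, hC, h''⟩ := h' ε₁ hε₁ hε₁le δ hδ hδ2
  refine ⟨C, hC, fun N y hy => ?_⟩
  obtain ⟨z, hadm, hF, hle⟩ := h'' N y hy
  exact ⟨z, hadm, by rw [hF, add_zero]; exact hle⟩

/-- **N_at's conclusion implies RD0c at `κ₁ := κ` (PROVED, `ẑ = y`):** the critical-reference line is still WEAKER than the target
(the tree's `nearReferenceLowOrders_of_conclusion` is the RD01 case). [this file] -/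
theorem nearReferenceCritical_of_conclusion {η R Rc δm ρ₁ θ θ₀ κ : ℝ} (hδm : 0 ≤ δm) (h : NearFloorConclusion ρ₁ θ θ₀ κ) :
    NearReferenceCriticalFloor η R Rc δm ρ₁ θ θ₀ κ := by
  intro _ ν hν
  obtain ⟨ε₀, hε₀, h'⟩ := h
  refine ⟨ε₀, hε₀, fun ε₁ hε₁ hε₁le δ hδ hδ2 => ?_⟩
  obtain ⟨C, hC, h''⟩ := h' ε₁ hε₁ hε₁le δ hδ hδ2
  refine ⟨C, hC, fun N y hy => ⟨y, refAdmissible_self hδm hy, by unfold firstSum; simp, ?_⟩⟩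
  have h1 := h'' N y hy
  have hQ : 0 ≤ ν * dispGradSum (101 / 100) (nearSet θ₀ ρ₁ ε₁ θ δ y) (goodSet ρ₁ ε₁ θ δ y) y y :=
    mul_nonneg hν.le (dispGradSum_nonneg _ _ _ _ _)
  linarith

/-! ## The record cones at the RE-CUT literals (appended by hand-2 g18 on landing; critic row 677 (a)(b)) -/

/-- **CONE LIII at the RE-CUT record literals** `(θ₀, κ) = (1/2000, 5·10⁻⁸)`, `κ₁ = κ₂ = 1/(4·10⁷)` (all other literals as in
`tbdsg_of_nearOrders_record`: `η = 3/2000`, `R = 4`, `Rc = 6`, `δm = 1/1000`, `ρ₁ = 12`, `θ = 1/25`) — critic row 677: at `θ₀ = 1/2000` the far-site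
floor is `c_Z·θ₀² = 1.43·10⁻⁷`, so the Z-slot literal `κ` is re-cut from `10⁻⁶` to `5·10⁻⁸` (safety 2.9); `tbdsg_of_nearOrders` instantiated. [hand-2 g18 for lens-4 g44] -/
theorem tbdsg_of_nearOrders_record'
    (hK : ∃ μ₁ μR : ℝ, 0 < μ₁ ∧ 0 < μR ∧ PureMarginStabilityAt (3 / 2000) μ₁ μR 4) (hR : AffineChartStraightening)
    (hD : DefectPairFloor) (hBT : BondTaylorExpansion)
    (h01 : NearReferenceLowOrders (3 / 2000) 4 6 (1 / 1000) 12 (1 / 25) (1 / 2000) (1 / (4 * 10 ^ 7)))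
    (h2 : NearSecondOrderFloor (3 / 2000) 4 6 (1 / 1000) 12 (1 / 25) (1 / 2000) (1 / (4 * 10 ^ 7)))
    (hZ : FarAggregatePricing 12 (1 / 25) (1 / 2000) (1 / (2 * 10 ^ 7))) (hM : AffMidAll 12 (1 / 25)) :
    TameBalancedDeepScaleGap (122 / 125) 0 4 (3 / 50) (1 / 450) :=
  tbdsg_of_nearOrders (3 / 2000) 4 6 (1 / 1000) 12 (1 / 25) (1 / 2000) (1 / (4 * 10 ^ 7)) (1 / (4 * 10 ^ 7)) (1 / (2 * 10 ^ 7))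
    (by norm_num) hK hR hD hBT h01 h2 (by norm_num) (by norm_num) hZ hM

/-- **CONE LIII with the CRITICAL-REFERENCE line at the RE-CUT record literals** `(θ₀, κ) = (1/2000, 5·10⁻⁸)`: RD0c
`NearReferenceCriticalFloor (3/2000) 4 6 (1/1000) 12 (1/25) (1/2000) (1/(4·10⁷))` in the RD01 slot via `nearReferenceLowOrders_of_critical`
(critic row 677 (b); the critic's probe `example`). [hand-2 g18 for lens-4 g44] -/
theorem tbdsg_of_nearCritical_record'
    (hK : ∃ μ₁ μR : ℝ, 0 < μ₁ ∧ 0 < μR ∧ PureMarginStabilityAt (3 / 2000) μ₁ μR 4) (hR : AffineChartStraightening)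
    (hD : DefectPairFloor) (hBT : BondTaylorExpansion)
    (h0c : NearReferenceCriticalFloor (3 / 2000) 4 6 (1 / 1000) 12 (1 / 25) (1 / 2000) (1 / (4 * 10 ^ 7)))
    (h2 : NearSecondOrderFloor (3 / 2000) 4 6 (1 / 1000) 12 (1 / 25) (1 / 2000) (1 / (4 * 10 ^ 7)))
    (hZ : FarAggregatePricing 12 (1 / 25) (1 / 2000) (1 / (2 * 10 ^ 7))) (hM : AffMidAll 12 (1 / 25)) :
    TameBalancedDeepScaleGap (122 / 125) 0 4 (3 / 50) (1 / 450) :=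
  tbdsg_of_nearOrders_record' hK hR hD hBT (nearReferenceLowOrders_of_critical h0c) h2 hZ hM

end Summit.AtomisticToContinuum.Crystallization.Theorems.OverbindingBudgetAffineNearCluster
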